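/-
Copyright: cell pub-balaban-gaps (YM BLITZ Y1, track G1), seat g1-p2 GEN 12 (unit `pub-balaban-gaps-g1-p2`).  Row (D4) NODE O,
MECHANISM level (instance bookkeeping for 127 ∕ 130): the PENALTIES of a partition from anchors — `pen_□(y) = max(0, d₁(y, z_□) − r)`
vanishes on the `r`-ball of the anchor `z_□` (where `supp h_□` and its neighbours live) — and the OVERLAP LETTER
`Σ_□ e^{−s·pen_□(a)} ≤ e^{sr}·n_D·c_s` from the cube row sum `(s, c_s)` and the anchor multiplicity `n_D`: NO volume factor.
HONEST FRAMING: [folklore]; nothing of Bałaban's constructed; words of row (D4) UNCHANGED; (D4) instance 0∕1; NOT BetaPertH, NOT continuum, NOT Clay.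
-/
import Summits.QuantumFields.BalabanUV.Gaps.D4WalkBlock

/-!
# `Gaps.D4WalkBlockPartitionOverlap` — penalties from anchors and the overlap letter of a partition from the cube row sum
# (cell pub-balaban-gaps, seat g1-p2 gen 12)

HONEST DEPENDENCY (cell pub-balaban, verbatim): continuum YM on T⁴ ⇐ BetaPertH ∧ nine spine estimates (0/9 proved);
BetaPertH ⇐ (D1) ∧ (D4) ∧ CAP+tail.

[B9] (3.87)–(3.90) p. 409: the cubes `□` of the partition are `M`-cubes, `supp h_□ ⊂ □̃`; a unit cube meets boundedly many `□̃`.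
* `pen_nonneg`, `pen_eq_zero_of_le` (the penalty `max(0, d₁(y, z) − r)` vanishes on the `r`-ball of the anchor), `exp_pen_le`
  (`e^{−s·pen(y)} ≤ e^{sr}e^{−sd₁(y,z)}`), `sum_anchors_le` (a sum over anchored cubes is `≤ n_D ×` the sum over cubes),
  **`overlap_letter_le`** (`Σ_□ e^{−s·pen_□(a)} ≤ e^{sr}·n_D·c_s` — the hypothesis `hN` of 127 ∕ 130 ∕ 131).
References (method only): T. Bałaban, Comm. Math. Phys. **99** (1985) [B9], (3.87)–(3.90) p. 409; [4] Lemma 2.1 (2.61) p. 234.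
-/

noncomputable section

namespace Summit.QuantumFields.BalabanUV.Gaps.D4WalkBlockPartitionOverlap

open Finset
open Literature.MathematicalPhysics.QuantumFieldTheory.Balaban1983to89
open Literature.MathematicalPhysics.QuantumFieldTheory.Balaban1983to89.B9Thm34Ext (toB6)
open Literature.MathematicalPhysics.QuantumFieldTheory.Balaban1983to89.B9Thm37GlueTorus (torusGeom tdist1 tdist1_nonneg)
open Literature.MathematicalPhysics.QuantumFieldTheory.Balaban1983to89.B5TorusCover (UT)
open Literature.MathematicalPhysics.QuantumFieldTheory.Balaban1983to89.B11SectG (RowSum)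

variable {ν : ℕ} {K : Fin ν → ℕ} [∀ i, NeZero (K i)]

/-- the anchored penalty is non-negative. ([folklore]) -/
theorem pen_nonneg (z y : UT K) (r : ℝ) : 0 ≤ max 0 (tdist1 K y z - r) := le_max_left _ _

/-- the anchored penalty vanishes on the `r`-ball of the anchor. ([folklore]) -/
theorem pen_eq_zero_of_le {z y : UT K} {r : ℝ} (h : tdist1 K y z ≤ r) : max 0 (tdist1 K y z - r) = 0 :=
  max_eq_left (by linarith)

/-- `e^{−s·max(0, d − r)} ≤ e^{sr}·e^{−sd}` for `s ≥ 0`. ([folklore]) -/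
theorem exp_pen_le (z y : UT K) {r s : ℝ} (hs : 0 ≤ s) :
    Real.exp (-(s * max 0 (tdist1 K y z - r))) ≤ Real.exp (s * r) * Real.exp (-(s * tdist1 K y z)) := by
  rw [← Real.exp_add]
  refine Real.exp_le_exp.2 ?_
  have h1 : tdist1 K y z - r ≤ max 0 (tdist1 K y z - r) := le_max_right _ _
  nlinarith

omit [∀ i, NeZero (K i)] in
/-- a sum over anchored indices is at most the anchor multiplicity times the sum over cubes (non-negative summands). ([folklore]) -/
theorem sum_anchors_le {B : Type} [Fintype B] (z : B → UT K) {nD : ℕ}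
    (hmult : ∀ y : UT K, (Finset.univ.filter fun b => z b = y).card ≤ nD) (f : UT K → ℝ) (hf : ∀ y, 0 ≤ f y) :
    ∑ b, f (z b) ≤ nD * ∑ y : UT K, f y := by
  classical
  rw [← Finset.sum_fiberwise_of_maps_to (g := z) (s := Finset.univ) (t := Finset.univ) (fun b _ => Finset.mem_univ _)
    (fun b => f (z b)), Finset.mul_sum]
  refine Finset.sum_le_sum fun y _ => ?_
  calc ∑ b ∈ Finset.univ.filter (fun b => z b = y), f (z b) = ∑ b ∈ Finset.univ.filter (fun b => z b = y), f y :=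
        Finset.sum_congr rfl fun b hb => by rw [(Finset.mem_filter.1 hb).2]
    _ = (Finset.univ.filter fun b => z b = y).card * f y := by rw [Finset.sum_const, nsmul_eq_mul]
    _ ≤ nD * f y := mul_le_mul_of_nonneg_right (by exact_mod_cast hmult y) (hf y)

/-- **THE OVERLAP LETTER OF AN ANCHORED PARTITION FROM THE CUBE ROW SUM**: anchors `z_b` with multiplicity `≤ n_D` per cube, radius `r`,
a cube row sum `(s, c_s)` at rate `s ≥ 0` ⟹ `Σ_b e^{−s·max(0, d₁(a, z_b) − r)} ≤ e^{sr}·n_D·c_s` for every cube `a` — the hypothesis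
`hN` of `D4WalkBlockPartitionSum.blockWalkExpansion_sum_localized` with `N = e^{sr}n_Dc_s`, NO volume factor.
[cite: Balaban1985BackgroundPropagators, (3.87)–(3.90) p.409; Balaban1984PropagatorsII, Lemma 2.1 (2.61) p.234] -/
theorem overlap_letter_le {B : Type} [Fintype B] (z : B → UT K) {nD : ℕ}
    (hmult : ∀ y : UT K, (Finset.univ.filter fun b => z b = y).card ≤ nD) {r s c : ℝ} (hs : 0 ≤ s)
    (hrow : RowSum (toB6 (torusGeom K 0 0 0) 0 True) s c) (a : UT K) :
    ∑ b, Real.exp (-(s * max 0 (tdist1 K a (z b) - r))) ≤ Real.exp (s * r) * nD * c := by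
  calc ∑ b, Real.exp (-(s * max 0 (tdist1 K a (z b) - r)))
      ≤ ∑ b, Real.exp (s * r) * Real.exp (-(s * tdist1 K a (z b))) := Finset.sum_le_sum fun b _ => exp_pen_le (z b) a hs
    _ = Real.exp (s * r) * ∑ b, Real.exp (-(s * tdist1 K a (z b))) := by rw [Finset.mul_sum]
    _ ≤ Real.exp (s * r) * (nD * ∑ y : UT K, Real.exp (-(s * tdist1 K a y))) :=
        mul_le_mul_of_nonneg_left (sum_anchors_le z hmult (fun y => Real.exp (-(s * tdist1 K a y))) fun _ => (Real.exp_pos _).le)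
          (Real.exp_pos _).le
    _ ≤ Real.exp (s * r) * (nD * c) :=
        mul_le_mul_of_nonneg_left (mul_le_mul_of_nonneg_left (hrow a) (Nat.cast_nonneg _)) (Real.exp_pos _).le
    _ = Real.exp (s * r) * nD * c := by ring

end Summit.QuantumFields.BalabanUV.Gaps.D4WalkBlockPartitionOverlap

end
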